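import Summits.ResolutionOfSingularities.ResolutionOfSingularities.Theorems.FrobeniusLadderFInjectiveMacaulayficationSeparableBaseChangeAscent
import HarnessLib

/-!
# (T-register #9/#9♯, kernel brick — LOCAL-RING FORM) ORDER CAP AND `p`-EDGE AT ANY POINT OF ANY REGULAR LOCAL RING: `𝔪^{d(p−1)+1} ⊆ 𝔪^{[p]}`, hence
# `f ∈ 𝔪^{d+1}` or `f = ℓ^p + h` (`ℓ ∈ 𝔪`, `h ∈ 𝔪^{p+1}`, `d ≤ p`) gives `f^{p−1} ∈ 𝔪^{[p]}` — the hypersurface `R/(f)` is never FULL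
# (crux `FInjectiveMacaulayfication` stmt-ResolutionOfSingularities-15315, chain w45a; the LOW item left open by ✓p712909 `FullPthPowerEdge` («the local-ring form (`R` regular local,
# `𝔪^{p²−1} ⊆ 𝔪^{[p]}`) is not typed here») and by ✓p710092 `FullNoKangaroo` (polynomial / `k`-point forms); res-L1-w45a-plan-1 R24.10 (4) «polynomial-ring form first»; seat
# res-L1-w45a-stub-1 g17)

[OURS · L1 W4.5a] Support file (`--supports stmt-ResolutionOfSingularities-15315 --as helper`); theorems only; GENERIC (any regular local ring of prime characteristic, any residue
field, closed point or not); no named fact; NOT a statement of any manuscript; nothing of the crux is proved (Fedder-test bookkeeping, evidence for T-register rows #9/#9♯ only).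
AI-written (AI review is weaker than expert review).

THE POINT. PIGEONHOLE (§1, any commutative ring, any exponent `q`): an ideal `𝔞` on `ν` generators satisfies `𝔞^{ν(q−1)+1} ⊆ 𝔞^{[q]}` (a monomial of degree `ν(q−1)+1` in the generators
has an exponent `≥ q`; formally: induction on `ν`, binomial expansion of `((g₀) ⊔ 𝔟)^N` in the semiring `Ideal R` as in Mathlibʼs `Ideal.sup_pow_add_le_pow_sup_pow` — the `n = 1` case of
✓ `stub_pigeonhole` (line `Sketch`), re-derived here in twelve lines because that file imports all of `Mathlib` and is outside the farmʼs build set); a regular local ring `(R, 𝔪)` of dimension `d` has `𝔪` on `d` generators (`IsRegularLocalRing.spanFinrank_maximalIdeal`), so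
`𝔪^{d(p−1)+1} ⊆ 𝔪^{[p]}` and in particular `𝔪^{(p+1)(p−1)} = 𝔪^{p²−1} ⊆ 𝔪^{[p]}` once `d ≤ p` (§2). Consequences (§3, characteristic-free at the ideal level):
* ORDER CAP (local form): `f ∈ 𝔪^{d+1}` ⇒ `f^{p−1} ∈ 𝔪^{(d+1)(p−1)} ⊆ 𝔪^{[p]}`;
* `p`-EDGE (local form): `d ≤ p`, `ℓ ∈ 𝔪`, `h ∈ 𝔪^{p+1}` ⇒ `(ℓ^p + h)^{p−1} ≡ h^{p−1} (mod 𝔪^{[p]})` and `h^{p−1} ∈ 𝔪^{p²−1} ⊆ 𝔪^{[p]}`.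
By Fedder (✓ `Fedder.fedder_hypersurface_clause_iff`, both directions, any regular local ring of characteristic `p`) either membership says that the hypersurface ring `R/(f)` (`f ≠ 0`)
VIOLATES the cruxʼs stalk clause (`CMCl ∧ FCl p`, hence `FullCl p`) (§4): **a hypersurface point of multiplicity `> dim R`, or — when `dim R ≤ p` — of multiplicity `p` with a `p`-th-power
initial form and remainder in `𝔪^{p+1}`, is never FULL**, at EVERY point (closed or not, any residue field) of EVERY regular ambient germ. These are the local-ring twins of the
polynomial/`k`-point statements ✓ `FullNoKangaroo.not_survivor_of_order_ge` / `exists_degree_le_of_survivor` (✓p710092, T-register #9: «FULL 4-fold hypersurface floor ⇒ mult ≤ 5») and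
✓ `FullPthPowerEdge.not_survivor_of_pth_power_add` (✓p712909, #9♯: the `p = 5` edge), now available at non-rational and non-closed points and after localisation/étale legs without
passing through coordinates. §1–§3 are universe-polymorphic and characteristic-free; §4 is universe `0` (as the clause abbreviations `CMCl`/`FCl`/`FullCl`).
* §1 `span_singleton_sup_pow_le_frobeniusPower` (inductive step), `span_range_pow_le_frobeniusPower` (`I = (g₁..g_ν)`, `N ≥ ν(q−1)+1` ⇒ `I^N ⊆ I^{[q]}`, any `q`), `span_finset_pow_le_frobeniusPower`,
  `pow_le_frobeniusPower_of_fg` (`N ≥ μ(I)(q−1)+1`);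
  §2 `exists_fin_span_eq_maximalIdeal`, ★★ `maximalIdeal_pow_le_frobeniusPower` (`𝔪^{d(p−1)+1} ⊆ 𝔪^{[p]}`), `maximalIdeal_pow_le_frobeniusPower_of_dim_le` (`d ≤ p`: `𝔪^{(p+1)(p−1)} ⊆ 𝔪^{[p]}`);
  §3 `pow_mem_frobeniusPower_of_mem_pow` (`f ∈ 𝔪^N`, `d(q−1) < mN` ⇒ `f^m ∈ 𝔪^{[q]}`), ★★ `pow_mem_frobeniusPower_of_mem_pow_succ_dim` (ORDER CAP), ★★ `pow_mem_frobeniusPower_of_eq_pow_add` (EDGE);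
  §4 `not_clause_of_pow_mem_frobeniusPower` / `not_fullCl_of_pow_mem_frobeniusPower` (Fedder necessity in clause letters), ★★★ `not_clause_of_mem_pow_succ_dim` / `not_fullCl_of_mem_pow_succ_dim`,
  ★★★ `not_clause_of_eq_pow_add` / `not_fullCl_of_eq_pow_add`.
[cite: Fedder1983, Prop. 1.7 and Thm. 1.12 (context: the survivor criterion)] [folklore computation]
-/

-- single-problem summit: the doubled namespace component is forced
set_option linter.dupNamespace false

open IsLocalRing Literature.RingTheory.TightClosure

namespace Summit.ResolutionOfSingularities.ResolutionOfSingularities.Theorems.FInjectiveMacaulayfication.FullLocalOrderCap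

open Summit.ResolutionOfSingularities.ResolutionOfSingularities.Theorems.FInjectiveMacaulayfication SliceableCentre

section Generic

variable {R : Type*} [CommRing R]

/-! ## §1 Pigeonhole: an ideal on `ν` generators satisfies `I^{ν(q−1)+1} ⊆ I^{[q]}` (any commutative ring, any `q`) -/

/-- **Inductive step of the pigeonhole.** If `𝔟^M ⊆ 𝔟^{[q]}` for every `M ≥ B`, then `((a) ⊔ 𝔟)^N ⊆ ((a) ⊔ 𝔟)^{[q]}` for every `N ≥ B + (q − 1)`: expand binomially in `Ideal R`; the term
`(a)^i 𝔟^{N−i}` lies in `((a) ⊔ 𝔟)^{[q]}` through `a^i = a^q·a^{i−q}` when `i ≥ q` and through `𝔟^{N−i}`, `N − i ≥ B`, when `i ≤ q − 1`. [folklore] -/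
theorem span_singleton_sup_pow_le_frobeniusPower (q : ℕ) (a : R) {J : Ideal R} {B : ℕ} (hJ : ∀ M : ℕ, B ≤ M → J ^ M ≤ frobeniusPower q J) {N : ℕ}
    (hN : B + (q - 1) ≤ N) :
    (Ideal.span {a} ⊔ J) ^ N ≤ frobeniusPower q (Ideal.span {a} ⊔ J) := by
  obtain ⟨K, hK⟩ : ∃ K : Ideal R, K = Ideal.span {a} ⊔ J := ⟨_, rfl⟩
  have haK : a ∈ K := hK ▸ Ideal.mem_sup_left (Ideal.mem_span_singleton_self a)
  have hJK : J ≤ K := hK ▸ le_sup_right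
  suffices h : (Ideal.span {a} ⊔ J) ^ N ≤ frobeniusPower q K by rwa [hK] at h
  rw [← Ideal.add_eq_sup, add_pow, Ideal.sum_eq_sup]
  refine Finset.sup_le fun i _ => Ideal.mul_le_right.trans ?_
  rcases le_or_gt q i with hqi | hqi
  · -- `i ≥ q`: `(a)^i = (a^i)`, `a^i = a^q · a^{i−q} ∈ K^{[q]}`
    refine Ideal.mul_le_right.trans ?_
    rw [Ideal.span_singleton_pow, Ideal.span_singleton_le_iff_mem, ← Nat.add_sub_of_le hqi, pow_add]
    exact Ideal.mul_mem_right _ _ (pow_mem_frobeniusPower haK)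
  · -- `i < q`: `N − i ≥ B`
    refine Ideal.mul_le_left.trans ((hJ (N - i) (by omega)).trans (frobeniusPower_mono q hJK))

/-- **`I^N ⊆ I^{[q]}` for `I = (g₁, …, g_ν)` and every `N ≥ ν(q−1)+1`** (a monomial of degree `N` in `ν` generators has an exponent `≥ q`) — any commutative ring, any `q : ℕ` (no primality,
no characteristic). Induction on `ν` through `span_singleton_sup_pow_le_frobeniusPower` (`Fin.range_fin_succ`, `Ideal.span_insert`). The `n = 1` case of ✓ `stub_pigeonhole`.
[folklore] -/
theorem span_range_pow_le_frobeniusPower (q : ℕ) :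
    ∀ {ν : ℕ} (g : Fin ν → R) {N : ℕ}, ν * (q - 1) + 1 ≤ N → Ideal.span (Set.range g) ^ N ≤ frobeniusPower q (Ideal.span (Set.range g)) := by
  intro ν
  induction ν with
  | zero =>
    intro g N hN
    have hN0 : N ≠ 0 := by omega
    rw [Set.range_eq_empty g, Ideal.span_empty, ← Ideal.zero_eq_bot, zero_pow hN0]
    exact bot_le
  | succ μ ih =>
    intro g N hN
    rw [Fin.range_fin_succ, Ideal.span_insert]
    refine span_singleton_sup_pow_le_frobeniusPower q (g 0) (B := μ * (q - 1) + 1) (fun M hM => ih (Fin.tail g) hM) ?_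
    have : (μ + 1) * (q - 1) = μ * (q - 1) + (q - 1) := Nat.succ_mul μ (q - 1)
    omega

/-- The range of the enumeration of a finset is the finset. [plumbing] -/
theorem range_equivFin_symm {α : Type*} (t : Finset α) : Set.range (fun i : Fin t.card => ((t.equivFin.symm i : t) : α)) = (t : Set α) := by
  ext x
  constructor
  · rintro ⟨i, rfl⟩
    exact (t.equivFin.symm i).2
  · intro hx
    exact ⟨t.equivFin ⟨x, hx⟩, by simp⟩

/-- **Finset form**: `(t)^N ⊆ (t)^{[q]}` for `N ≥ |t|·(q−1)+1`. [folklore] -/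
theorem span_finset_pow_le_frobeniusPower (q : ℕ) (t : Finset R) {N : ℕ} (hN : t.card * (q - 1) + 1 ≤ N) :
    Ideal.span (t : Set R) ^ N ≤ frobeniusPower q (Ideal.span (t : Set R)) := by
  rw [← range_equivFin_symm t]
  exact span_range_pow_le_frobeniusPower q _ hN

/-- **Finitely generated form**: for a finitely generated ideal `I` with minimal number of generators `μ(I) = I.spanFinrank`, `I^N ⊆ I^{[q]}` for every `N ≥ μ(I)(q−1)+1`.
[folklore] -/
theorem pow_le_frobeniusPower_of_fg (q : ℕ) {I : Ideal R} (hI : I.FG) {N : ℕ} (hN : I.spanFinrank * (q - 1) + 1 ≤ N) :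
    I ^ N ≤ frobeniusPower q I := by
  obtain ⟨t, ht, hspan⟩ := Submodule.FG.exists_span_finset_card_eq_spanFinrank hI
  rw [Ideal.submodule_span_eq] at hspan
  rw [← ht] at hN
  rw [← hspan]
  exact span_finset_pow_le_frobeniusPower q t hN

/-! ## §2 Regular local rings: `𝔪^{d(p−1)+1} ⊆ 𝔪^{[p]}` -/

/-- The maximal ideal of a regular local ring of dimension `d` is generated by `d` elements (the defining property, `IsRegularLocalRing.spanFinrank_maximalIdeal`, as a `Fin d`-indexed
family). [cite: Matsumura1987, §14 (definition of a regular local ring)] -/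
theorem exists_fin_span_eq_maximalIdeal [IsRegularLocalRing R] {d : ℕ} (hd : ringKrullDim R = d) :
    ∃ g : Fin d → R, Ideal.span (Set.range g) = maximalIdeal R := by
  have hfg : (maximalIdeal R).FG := IsNoetherian.noetherian _
  obtain ⟨t, ht, hspan⟩ := Submodule.FG.exists_span_finset_card_eq_spanFinrank hfg
  rw [Ideal.submodule_span_eq] at hspan
  have hrk : (maximalIdeal R).spanFinrank = d := by
    have h := IsRegularLocalRing.spanFinrank_maximalIdeal (R := R)
    rw [hd] at h
    exact_mod_cast h
  rw [hrk] at ht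
  subst ht
  exact ⟨fun i : Fin t.card => ((t.equivFin.symm i : t) : R), by rw [range_equivFin_symm t, hspan]⟩

/-- ★★ **`𝔪^N ⊆ 𝔪^{[q]}` for `N ≥ d(q−1)+1` in a regular local ring of dimension `d`** (any `q`; no characteristic hypothesis at the ideal level: `𝔪^{[q]}` is the ideal generated by all
`q`-th powers of elements of `𝔪`). [folklore; OURS bookkeeping] -/
theorem maximalIdeal_pow_le_frobeniusPower [IsRegularLocalRing R] (q : ℕ) {d : ℕ} (hd : ringKrullDim R = d) {N : ℕ} (hN : d * (q - 1) + 1 ≤ N) :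
    maximalIdeal R ^ N ≤ frobeniusPower q (maximalIdeal R) := by
  obtain ⟨g, hg⟩ := exists_fin_span_eq_maximalIdeal hd
  rw [← hg]
  exact span_range_pow_le_frobeniusPower q g hN

/-- `d(p−1)+1 ≤ (p+1)(p−1)` when `d ≤ p` and `p ≥ 2`. [plumbing] -/
theorem dim_mul_pred_succ_le {p d : ℕ} (hp : p.Prime) (hdp : d ≤ p) : d * (p - 1) + 1 ≤ (p + 1) * (p - 1) := by
  have h2 := hp.two_le
  set c := p - 1 with hc
  have h1 : d * c ≤ p * c := Nat.mul_le_mul_right _ hdp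
  have h3 : (p + 1) * c = p * c + c := by rw [add_mul, one_mul]
  rw [h3]
  omega

/-- **`𝔪^{(p+1)(p−1)} = 𝔪^{p²−1} ⊆ 𝔪^{[p]}` when `dim R = d ≤ p`** — the inclusion quoted (untyped) in ✓p712909ʼs docstring. [folklore; OURS bookkeeping] -/
theorem maximalIdeal_pow_le_frobeniusPower_of_dim_le [IsRegularLocalRing R] {p : ℕ} (hp : p.Prime) {d : ℕ} (hd : ringKrullDim R = d) (hdp : d ≤ p) :
    maximalIdeal R ^ ((p + 1) * (p - 1)) ≤ frobeniusPower p (maximalIdeal R) :=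
  maximalIdeal_pow_le_frobeniusPower p hd (dim_mul_pred_succ_le hp hdp)

/-! ## §3 Order cap and `p`-edge, local forms (characteristic-free at the ideal level) -/

/-- **High order forces membership in `𝔪^{[q]}`**: `f ∈ 𝔪^N` and `d(q−1) < m·N` ⇒ `f^m ∈ 𝔪^{[q]}` (`dim R = d`; any `q`). [folklore; OURS bookkeeping] -/
theorem pow_mem_frobeniusPower_of_mem_pow [IsRegularLocalRing R] (q : ℕ) {d : ℕ} (hd : ringKrullDim R = d) {f : R} {N m : ℕ}
    (hf : f ∈ maximalIdeal R ^ N) (hlt : d * (q - 1) < m * N) :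
    f ^ m ∈ frobeniusPower q (maximalIdeal R) := by
  have h1 : f ^ m ∈ maximalIdeal R ^ (N * m) := by
    rw [pow_mul]
    exact Ideal.pow_mem_pow hf m
  refine maximalIdeal_pow_le_frobeniusPower q hd ?_ h1
  rw [Nat.mul_comm N m]
  omega

/-- ★★ **ORDER CAP, local form**: in a regular local ring of dimension `d` (any prime `p`), `f ∈ 𝔪^{d+1}` ⇒ `f^{p−1} ∈ 𝔪^{[p]}` — a hypersurface of multiplicity `> dim R` fails Fedderʼs test.
The local twin of ✓ `FullNoKangaroo.not_survivor_of_order_ge` (✓p710092; there: `k[X₁..X_n]` at the origin). [OURS · T-register #9, local form; folklore computation] -/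
theorem pow_mem_frobeniusPower_of_mem_pow_succ_dim [IsRegularLocalRing R] {p : ℕ} (hp : p.Prime) {d : ℕ} (hd : ringKrullDim R = d) {f : R}
    (hf : f ∈ maximalIdeal R ^ (d + 1)) :
    f ^ (p - 1) ∈ frobeniusPower p (maximalIdeal R) := by
  refine pow_mem_frobeniusPower_of_mem_pow p hd hf ?_
  -- `d(p−1) < (p−1)(d+1)` since `p − 1 ≥ 1`
  have h2 := hp.two_le
  set c := p - 1 with hc
  have : c * (d + 1) = d * c + c := by ring
  omega

/-- **`(T + h)^m ∈ J ↔ h^m ∈ J` when `T ∈ J`.** [folklore] -/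
theorem add_pow_mem_iff_of_mem (J : Ideal R) {T : R} (hT : T ∈ J) (h : R) (m : ℕ) : (T + h) ^ m ∈ J ↔ h ^ m ∈ J := by
  rw [← Ideal.Quotient.eq_zero_iff_mem, ← Ideal.Quotient.eq_zero_iff_mem, map_pow, map_pow, map_add, Ideal.Quotient.eq_zero_iff_mem.mpr hT, zero_add]

/-- ★★ **THE `p`-EDGE, local form**: in a regular local ring of dimension `d ≤ p`, `ℓ ∈ 𝔪` and `h ∈ 𝔪^{p+1}` ⇒ `(ℓ^p + h)^{p−1} ∈ 𝔪^{[p]}` (`ℓ^p ∈ 𝔪^{[p]}` by definition, and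
`h^{p−1} ∈ 𝔪^{(p+1)(p−1)} ⊆ 𝔪^{d(p−1)+1} ⊆ 𝔪^{[p]}`). The local twin of ✓ `FullPthPowerEdge.not_survivor_of_pth_power_add` (✓p712909; there: `A[X₁..X_n]`, `n ≤ p`, at the origin).
[OURS · T-register #9♯, local form; folklore computation] -/
theorem pow_mem_frobeniusPower_of_eq_pow_add [IsRegularLocalRing R] {p : ℕ} (hp : p.Prime) {d : ℕ} (hd : ringKrullDim R = d) (hdp : d ≤ p) {ℓ h : R}
    (hℓ : ℓ ∈ maximalIdeal R) (hh : h ∈ maximalIdeal R ^ (p + 1)) (f : R) (hf : f = ℓ ^ p + h) :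
    f ^ (p - 1) ∈ frobeniusPower p (maximalIdeal R) := by
  rw [hf, add_pow_mem_iff_of_mem _ (pow_mem_frobeniusPower hℓ)]
  refine pow_mem_frobeniusPower_of_mem_pow p hd hh ?_
  have h := dim_mul_pred_succ_le hp hdp
  rw [Nat.mul_comm (p + 1)] at h
  omega

end Generic

/-! ## §4 Fedder readings: such hypersurface points are never FULL (regular local rings of characteristic `p`; universe `0` as the clause abbreviations) -/

section Fedder

variable {R : Type} [CommRing R] (p : ℕ) [Fact p.Prime]

/-- **Fedder necessity in clause letters**: `R` regular local of characteristic `p`, `f ∈ 𝔪`, `f ≠ 0`, `f^{p−1} ∈ 𝔪^{[p]}` ⇒ the hypersurface ring `R/(f)` violates `CMCl ∧ FCl p` (some parameter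
ideal is not Frobenius closed). (✓ `Fedder.fedder_hypersurface_clause_iff` + ✓ `SeparableBaseChangeAscent.cmCl_and_fCl_iff`.) [cite: Fedder1983, Prop. 1.7 and Thm. 1.12] -/
theorem not_clause_of_pow_mem_frobeniusPower [IsRegularLocalRing R] [CharP R p] {f : R} (hfm : f ∈ maximalIdeal R) (hf0 : f ≠ 0)
    (hfed : f ^ (p - 1) ∈ frobeniusPower p (maximalIdeal R)) :
    ¬ (CMCl (R ⧸ Ideal.span {f}) ∧ FCl p (R ⧸ Ideal.span {f})) := by
  rw [SeparableBaseChangeAscent.cmCl_and_fCl_iff, Fedder.fedder_hypersurface_clause_iff p hfm hf0]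
  exact fun h => h hfed

/-- The same in the `FullCl` letter: `f^{p−1} ∈ 𝔪^{[p]}` ⇒ `R/(f)` is not FULL. [cite: Fedder1983, Prop. 1.7 and Thm. 1.12] -/
theorem not_fullCl_of_pow_mem_frobeniusPower [IsRegularLocalRing R] [CharP R p] {f : R} (hfm : f ∈ maximalIdeal R) (hf0 : f ≠ 0)
    (hfed : f ^ (p - 1) ∈ frobeniusPower p (maximalIdeal R)) :
    ¬ FullCl p (R ⧸ Ideal.span {f}) :=
  fun h => not_clause_of_pow_mem_frobeniusPower p hfm hf0 hfed ((SeparableBaseChangeAscent.cmCl_and_fCl_iff p _).mpr h.2)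

/-- ★★★ **ORDER CAP, Fedder reading**: in a regular local ring `R` of characteristic `p` and dimension `d`, a nonzero `f ∈ 𝔪^{d+1}` (multiplicity `> dim R`) defines a hypersurface ring `R/(f)`
violating the cruxʼs stalk clause `CMCl ∧ FCl p` — at any point of any regular ambient germ, any residue field, every prime `p`. On a FULL hypersurface `e`-fold floor (ambient
dimension `≤ e + 1` at every scheme point) every point has multiplicity `≤ e + 1`; for `e = 4`: `≤ 5` (T-register #9, now at all points). [OURS · T-register #9, local form;
cite: Fedder1983, Prop. 1.7 and Thm. 1.12] -/
theorem not_clause_of_mem_pow_succ_dim [IsRegularLocalRing R] [CharP R p] {d : ℕ} (hd : ringKrullDim R = d) {f : R} (hf : f ∈ maximalIdeal R ^ (d + 1)) (hf0 : f ≠ 0) :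
    ¬ (CMCl (R ⧸ Ideal.span {f}) ∧ FCl p (R ⧸ Ideal.span {f})) :=
  not_clause_of_pow_mem_frobeniusPower p (Ideal.pow_le_self (Nat.succ_ne_zero d) hf) hf0
    (pow_mem_frobeniusPower_of_mem_pow_succ_dim (Fact.out : p.Prime) hd hf)

/-- ★★★ ORDER CAP, `FullCl` letter: `f ∈ 𝔪^{dim R + 1}`, `f ≠ 0` ⇒ `R/(f)` is not FULL. [OURS · T-register #9, local form; cite: Fedder1983, Prop. 1.7 and Thm. 1.12] -/
theorem not_fullCl_of_mem_pow_succ_dim [IsRegularLocalRing R] [CharP R p] {d : ℕ} (hd : ringKrullDim R = d) {f : R} (hf : f ∈ maximalIdeal R ^ (d + 1)) (hf0 : f ≠ 0) :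
    ¬ FullCl p (R ⧸ Ideal.span {f}) :=
  not_fullCl_of_pow_mem_frobeniusPower p (Ideal.pow_le_self (Nat.succ_ne_zero d) hf) hf0
    (pow_mem_frobeniusPower_of_mem_pow_succ_dim (Fact.out : p.Prime) hd hf)

/-- `ℓ^p + h ∈ 𝔪` for `ℓ ∈ 𝔪`, `h ∈ 𝔪^{p+1}`. [plumbing] -/
theorem pow_add_mem_maximalIdeal [IsLocalRing R] {ℓ h : R} (hℓ : ℓ ∈ maximalIdeal R) (hh : h ∈ maximalIdeal R ^ (p + 1)) (f : R) (hf : f = ℓ ^ p + h) :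
    f ∈ maximalIdeal R := by
  rw [hf]
  exact Ideal.add_mem _ (Ideal.pow_mem_of_mem _ hℓ p (Fact.out : p.Prime).pos) (Ideal.pow_le_self (Nat.succ_ne_zero p) hh)

/-- ★★★ **THE `p`-EDGE, Fedder reading**: in a regular local ring `R` of characteristic `p` and dimension `d ≤ p`, a nonzero `f = ℓ^p + h` with `ℓ ∈ 𝔪`, `h ∈ 𝔪^{p+1}` (multiplicity-`p`
point whose initial form is the `p`-th power of a linear form — or `ℓ ∈ 𝔪²` and multiplicity `> p` — with the remainder in `𝔪^{p+1}`) defines a hypersurface ring `R/(f)` violating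
`CMCl ∧ FCl p`: such points do not occur on FULL hypersurface floors of dimension `≤ p − 1` (for `p = 5`: FULL 4-fold hypersurface floors, T-register #9♯), at any point, any residue
field. [OURS · T-register #9♯, local form; cite: Fedder1983, Prop. 1.7 and Thm. 1.12] -/
theorem not_clause_of_eq_pow_add [IsRegularLocalRing R] [CharP R p] {d : ℕ} (hd : ringKrullDim R = d) (hdp : d ≤ p) {ℓ h : R} (hℓ : ℓ ∈ maximalIdeal R)
    (hh : h ∈ maximalIdeal R ^ (p + 1)) (f : R) (hf : f = ℓ ^ p + h) (hf0 : f ≠ 0) :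
    ¬ (CMCl (R ⧸ Ideal.span {f}) ∧ FCl p (R ⧸ Ideal.span {f})) :=
  not_clause_of_pow_mem_frobeniusPower p (pow_add_mem_maximalIdeal p hℓ hh f hf) hf0
    (pow_mem_frobeniusPower_of_eq_pow_add (Fact.out : p.Prime) hd hdp hℓ hh f hf)

/-- ★★★ THE `p`-EDGE, `FullCl` letter: `dim R = d ≤ p`, `f = ℓ^p + h ≠ 0`, `ℓ ∈ 𝔪`, `h ∈ 𝔪^{p+1}` ⇒ `R/(f)` is not FULL. [OURS · T-register #9♯, local form; cite: Fedder1983, Prop. 1.7 and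
Thm. 1.12] -/
theorem not_fullCl_of_eq_pow_add [IsRegularLocalRing R] [CharP R p] {d : ℕ} (hd : ringKrullDim R = d) (hdp : d ≤ p) {ℓ h : R} (hℓ : ℓ ∈ maximalIdeal R)
    (hh : h ∈ maximalIdeal R ^ (p + 1)) (f : R) (hf : f = ℓ ^ p + h) (hf0 : f ≠ 0) :
    ¬ FullCl p (R ⧸ Ideal.span {f}) :=
  not_fullCl_of_pow_mem_frobeniusPower p (pow_add_mem_maximalIdeal p hℓ hh f hf) hf0
    (pow_mem_frobeniusPower_of_eq_pow_add (Fact.out : p.Prime) hd hdp hℓ hh f hf)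

end Fedder

end Summit.ResolutionOfSingularities.ResolutionOfSingularities.Theorems.FInjectiveMacaulayfication.FullLocalOrderCap
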